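import Summits.SmoothPoincare4.SmoothPoincare4.Theorems.SullivanDualHyperbolicEndTaubesModelIdentities

/-!
# Route `SullivanDual`, crux `HyperbolicEnd` (stmt-SmoothPoincare4-7825), line `taubes-circle-pencil`:
# `J♭` intertwines Taubes' coframe

Registered helper `helper_taubesJ_coframe`: on the punctured tube Taubes' singular structure `J♭ = taubesJ`
exchanges the two complex lines `span(∂_t, ∇Q)` and `ker dt ∩ ker dQ` of Taubes' coordinates
`(t, f = Q, h = H, φ)` (Geom. Topol. 2 (1998), eqs. (1.4), (1.10)–(1.11): `ω = dt∧df + dφ∧dh`, metric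
diagonal), namely `dt ∘ J♭ = −dQ/|∇Q|`, `dQ ∘ J♭ = |∇Q| dt`, `dH ∘ J♭ = |∇Q| ρ²dφ`,
`ρ²dφ ∘ J♭ = −dH/|∇Q|` with `H = c(a² + b²)`, `ρ²dφ = a db − b da` (everything polynomial in the flat
blocks, so no `arg`).  These are the pointwise identities behind the drift-Laplace equations for
`t, f, h, φ` on `J♭`-curves and the quasiregularity of `Φ = t + if` on leaves (lead memo / SM analysis of
the crux workfiles).  Proof: toroidal components of `J♭u` (`taubesJ_components`) + `field_simp` +
`linear_combination` against `|∇Q|² = a² + b² + 4c²`.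
-/

-- the registered namespace `Summit.SmoothPoincare4.SmoothPoincare4.…` repeats a component (P = Sub)
set_option linter.dupNamespace false

noncomputable section

namespace Summit.SmoothPoincare4.SmoothPoincare4.Cruxes.HyperbolicEnd.TaubesCirclePencil

/-- **`J♭` intertwines Taubes' coframe** on the punctured tube: `dt(J♭u) = −dQ(u)/|∇Q|`,
`dQ(J♭u) = |∇Q| dt(u)`, `dH(J♭u) = |∇Q| (ρ²dφ)(u)`, `(ρ²dφ)(J♭u) = −dH(u)/|∇Q|`, where
`H = y₃((r−1)² + y₂²)`, `dH(u) = ((r−1)² + y₂²) u₃ + 2y₃((r−1) da(u) + y₂ u₂)` and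
`(ρ²dφ)(u) = (r−1) u₂ − y₂ da(u)` (Taubes 1998, (1.4), (1.10)). [folklore] -/
theorem helper_taubesJ_coframe :
    ∀ (δ : ℝ) (y : EuclideanSpace ℝ (Fin 4)), 0 < δ → δ < 1 → y ∈ taubesTube δ → y ∉ taubesCore →
      ∀ u : EuclideanSpace ℝ (Fin 4),
        taubesDt y (taubesJ y u) = -(taubesDQ y u) / taubesGrad y ∧
        taubesDQ y (taubesJ y u) = taubesGrad y * taubesDt y u ∧
        ((taubesR y - 1) ^ 2 + y 2 ^ 2) * (taubesJ y u) 3 +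
            2 * y 3 * ((taubesR y - 1) * taubesDa y (taubesJ y u) + y 2 * (taubesJ y u) 2) =
          taubesGrad y * ((taubesR y - 1) * u 2 - y 2 * taubesDa y u) ∧
        (taubesR y - 1) * (taubesJ y u) 2 - y 2 * taubesDa y (taubesJ y u) =
          -(((taubesR y - 1) ^ 2 + y 2 ^ 2) * u 3 +
              2 * y 3 * ((taubesR y - 1) * taubesDa y u + y 2 * u 2)) / taubesGrad y := by
  intro δ y hδ0 hδ hy hc u
  have hr := helper_taubesR_pos δ y hδ0 hδ hy
  have hm := helper_taubesGrad_pos δ y hδ0 hδ hy hc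
  have hm0 : taubesGrad y ≠ 0 := hm.ne'
  have hmsq := taubesGrad_sq y
  obtain ⟨hJ0, hJ1, hJ2, hJ3⟩ := taubesJ_components y u hr
  refine ⟨?_, ?_, ?_, ?_⟩
  · rw [hJ0, taubesDQ]
    ring
  · simp only [taubesDQ]
    rw [hJ1, hJ2, hJ3]
    have hP : (taubesR y - 1) * ((taubesR y - 1) * taubesDt y u + y 2 * u 3 + 2 * y 3 * u 2) +
        y 2 * (-(taubesR y - 1) * u 3 + y 2 * taubesDt y u - 2 * y 3 * taubesDa y u) -
        2 * y 3 * ((taubesR y - 1) * u 2 - y 2 * taubesDa y u - 2 * y 3 * taubesDt y u) =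
        taubesGrad y ^ 2 * taubesDt y u := by
      rw [hmsq]; ring
    field_simp
    linear_combination hP
  · rw [hJ1, hJ2, hJ3]
    have hP : ((taubesR y - 1) ^ 2 + y 2 ^ 2) * ((taubesR y - 1) * u 2 - y 2 * taubesDa y u -
          2 * y 3 * taubesDt y u) +
        2 * y 3 * ((taubesR y - 1) * ((taubesR y - 1) * taubesDt y u + y 2 * u 3 + 2 * y 3 * u 2) +
          y 2 * (-(taubesR y - 1) * u 3 + y 2 * taubesDt y u - 2 * y 3 * taubesDa y u)) =
        taubesGrad y ^ 2 * ((taubesR y - 1) * u 2 - y 2 * taubesDa y u) := by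
      rw [hmsq]; ring
    field_simp
    linear_combination hP
  · rw [hJ1, hJ2]
    field_simp
    ring

end Summit.SmoothPoincare4.SmoothPoincare4.Cruxes.HyperbolicEnd.TaubesCirclePencil

end
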